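import Literature.MathematicalPhysics.QuantumFieldTheory.Balaban1983to89.B9Eq376POneLetters

/-!
# `Balaban1983to89.B9Eq376DerivDict` — [Balaban1985BackgroundPropagators] (3.3)/(3.8) pp. 391–392: the dictionary between the TWO typings of the
# covariant-derivative letters `D_U`, `D*_U` in the cell's block-majorant calculus — the two-space letters `conjHom b (gradLin …)` (sites → bonds),
# `conjHom b (divLin …)` (bonds → sites) of `B9Eq376POneLetters` (FILE 10; the typing of (3.76)/(3.49)/(3.68) in FILES 11–13) and the
# one-carrier DIRECTIONAL letters `conj b (diffLetter … k)`, `k ∈ κ ⊕ κ`, of `B9Eq352GradLetters` (the typing of the concrete `V′`/(3.63)/(3.68)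
# files of gens 8–10) — so that a per-direction (3.42)₂,₃/(3.49)/(3.68)-type entry `|∇_μT|`, `|T∇*_ν|`, `|∇_μT∇*_ν|` yields the typed composite

statement-level skeleton of published theorems with citation tags; proofs where landed; nothing here is a claim about the Yang–Mills mass gap

CITATION HEADER (lean-in-tree rule).  B9 = T. Bałaban, *Propagators for lattice gauge theories in a background field*, Commun. Math. Phys.
**99** (1985) 389–434 [Balaban1985BackgroundPropagators] (held `paper:balaban1985-cmp99-background-propagators`; journal page = PDF page + 388):
(3.3) p. 391 («(D^η_{U₀}A)(b) = η⁻¹(R(U₀(b))A(b₊) − A(b₋)), or (D^η_{U₀,μ}A)(x) = (D^η_{U₀}A)(x, x + ηe_μ), μ = 1, …, d» — the display opens at the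
foot of p. 390, its label is printed on p. 391), (3.8) p. 392 («(D\*A)(x) = Σ_{μ=1}^d (D\*_μA_μ)(x) = Σ_{μ=1}^d (DA_μ)(x, x − ηe_μ)»), (3.39) p. 397
(«|A| = max_μ sup_x |A_μ(x)|»), the remark p. 398 («the choice of derivatives ∇_U, ∇\*_U is conventional, we may always replace ∇_U by ∇\*_U, and vice
versa, in arbitrary place and combination»), (3.42) p. 397, (3.49) p. 399, (3.68) p. 403, (3.76) p. 405.  [4] = [Balaban1984PropagatorsII]
(2.51)–(2.52) p. 232.  Cell `lit-balaban`, seat r06 (B9 fold owner) gen 12, FILE 14 of the Sect. B programme; rows B9.Eq3.3 × B9.Eq3.8 × B9.Eq3.42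
× B9.Eq3.49 × B9.Eq3.68 × B9.Eq3.76 (typing dictionary; no row head changes).

WHY.  Two lineages of this cell type `∇_U`, `∇*_U` differently.  (a) FILES 10–13 (`B9Eq376POneLetters`, `B9Ineq377POneConcrete`, `B9Ineq349Hom`,
`B9Ineq349PConcrete`): `D := conjHom b (gradLin T c U) : (S × ι → ℝ) →ₗ ((κ × S) × ι → ℝ)` (a site function to the BOND function
`(μ, x) ↦ c·(D_μf)(x)`, all directions at once — the print's `D` of (3.26)/(3.76)) and `D* := conjHom b (divLin T c U)` (a bond function to
`x ↦ c·Σ_ν(D*_νF_ν)(x)`, (3.8)).  (b) gens 8–10 (`B9Eq352GradLetters`, `B9Eq360VprimeLetters`, `B9Ineq363Vprime`, `B9Ineq368Vprime`): the DIRECTIONAL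
letters `conj b (diffLetter T U c k)`, `k ∈ κ ⊕ κ` (`inl μ ↦ c·D_μ`, `inr ν ↦ −c·D*_ν`), endomorphisms of the site carrier `S × ι → ℝ`, in which
Theorem 3.1's entries (3.42)₂,₃ are hypotheses `∀ k, conj b (diffLetter k) * G′ ≺ …`, `∀ k, G′ * conj b (diffLetter k) ≺ …` (p. 398: the choice
`∇`/`∇*` is conventional) and the (3.68) entries of the concrete `P′(A)` are proved with arbitrary one-carrier end letters.  This file is the
(elementary) dictionary (b) ⇒ (a), so that the remaining `P′(A)`-hypotheses `hPp`/`hDPp`/`hPpDs`/`hDPpDs` and the `G′(U)`-entries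
`hDGp`/`hGpDs` of FILE 13's `B9Ineq349PConcrete.thm34_G_entries13_concreteP` can be fed from lineage (b).

WHAT THIS FILE PROVES (0 sorry; one plumbing `def` with body — `dirRestr ν`, the restriction of a bond function to the direction `ν` —; theorems).
* §1 `dirRestr ν : ((κ × S) × ι → ℝ) →ₗ[ℝ] (S × ι → ℝ)`, `F ↦ ((x,i) ↦ F((ν,x),i))`; `dirRestr_apply`; `blockSupp_dirRestr` (block supports are kept,
  bond block map `q ↦ y(q.1.2)`); `coordEquiv_symm_dir` (the `E`-valued direction-`ν` component of `coord⁻¹F` is `coord⁻¹(dirRestr ν F)`).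
* §2 the POINTWISE IDENTITIES: `conjHom_gradLin_apply` — `(conjHom b (gradLin T c V) m)((μ,x),i) = (conj b (diffLetter T V c (inl μ)) m)(x,i)`;
  `conjHom_gradLin_comp_apply` (the same after a site letter `P`); `conjHom_divLin_eq_sum` — `conjHom b (divLin T c V) F = −Σ_ν conj b (diffLetter
  T V c (inr ν)) (dirRestr ν F)` ((3.8): `D* = Σ_ν D*_ν`, and `diffLetter (inr ν) = −c·D*_ν`); `comp_conjHom_divLin_apply`,
  `conjHom_gradLin_comp_comp_divLin_apply` (one- and two-sided dressings of a site letter `P`).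
* §3 THE DICTIONARY for block majorants (site block map `p ↦ y(p.1)`, bond block map `q ↦ y(q.1.2)`, any majorant `K`, resp. `K ≧ 0`):
  **`hasMajorantHom_gradLin_comp`** — `(∀ μ, conj b (diffLetter (inl μ)) * P ≺ K) → conjHom b (gradLin) ∘ₗ P ≺ K` (sites → bonds);
  **`hasMajorantHom_comp_divLin`** — `(∀ ν, P * conj b (diffLetter (inr ν)) ≺ K) → P ∘ₗ conjHom b (divLin) ≺ card κ · K` (bonds → sites);
  **`hasMajorant_gradLin_comp_comp_divLin`** — `(∀ μ ν, conj b (diffLetter (inl μ)) * P * conj b (diffLetter (inr ν)) ≺ K) → conjHom b (gradLin) ∘ₗ P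
  ∘ₗ conjHom b (divLin) ≺ card κ · K` (bonds → bonds); and the `P = 1` forms `hasMajorantHom_gradLin`, `hasMajorantHom_divLin`.
  These are exactly the shapes `hDP`/`hPDs` (resp. `hDPp`/`hPpDs`/`hDPpDs`, `hDGp`/`hGpDs`) of FILES 11/13 on the left and the per-direction
  hypotheses `h342_2`/`h342_3`/conclusions of `B9Ineq368Vprime` on the right.

HONEST SCOPE / NOT CLAIMED.  Pure typing bookkeeping between two existing vocabularies of the cell (no estimate of the paper is proved here); the
factor `card κ = d` in the bonds → sites direction is the honest cost of `D* = Σ_ν D*_ν` for a direction-blind majorant `K`.  No row head changes;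
NOT summit progress.

RELATED IN THE TREE, NOT DUPLICATED (searched 2026-08-22: `lean search 'dirRestr|DerivDict|hasMajorantHom_gradLin_comp|hasMajorantHom_comp_divLin'`
= ∅): `B9Eq376POneLetters` (`conjHom`, `gradLin`, `divLin`, `conjHom_apply`, `gradLin_apply`, `divLin_apply` USED BY NAME), `B9Eq352DivFormLetters`
(`coordEquiv`, `conj`, `conj_apply`, `coordEquiv_symm_apply`, `gradLetterF/B(_apply)`), `B9Eq352GradLetters` (`diffLetter`, `diffLetter_inl/inr`);
`B9Ineq386V3Concrete`/`B9Ineq385V3Concrete` use the bond-carrier directional letters `diffLetter (bT T) (bU U)` (a third typing, for `G(U)` on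
bonds — not touched here).
-/

noncomputable section

namespace Literature.MathematicalPhysics.QuantumFieldTheory.Balaban1983to89.B9Eq376DerivDict

open Literature.MathematicalPhysics.QuantumFieldTheory.Balaban1983to89
open Literature.MathematicalPhysics.QuantumFieldTheory.Balaban1983to89.B6RandomWalk (HasMajorant BlockSupp)
open Literature.MathematicalPhysics.QuantumFieldTheory.Balaban1983to89.B6RandomWalkHom (HasMajorantHom)
open Literature.MathematicalPhysics.QuantumFieldTheory.Balaban1983to89.B9Thm34Ext (toB6)
open Literature.MathematicalPhysics.QuantumFieldTheory.Balaban1983to89.B9Eq39Adjoint (covD covDstar)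
open Literature.MathematicalPhysics.QuantumFieldTheory.Balaban1983to89.B9Eq352DivFormLetters (coordEquiv conj conj_apply
  coordEquiv_symm_apply gradLetterF gradLetterB gradLetterF_apply gradLetterB_apply)
open Literature.MathematicalPhysics.QuantumFieldTheory.Balaban1983to89.B9Eq352GradLetters (diffLetter diffLetter_inl diffLetter_inr)
open Literature.MathematicalPhysics.QuantumFieldTheory.Balaban1983to89.B9Eq376POneLetters (conjHom conjHom_apply gradLin divLin
  gradLin_apply divLin_apply)

/-! ## §1  The restriction of a bond function to one direction -/

section Restrict

variable {ι : Type} {S : Type} {κ : Type}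

/-- The restriction of a (real-coordinate) bond function to the bonds of direction `ν`: `F ↦ ((x,i) ↦ F((ν,x),i))` — the `ν`-th component `A_ν` of
a bond function `A` ((3.39): «|A| = max_μ sup_x |A_μ(x)|»). [cite: Balaban1985BackgroundPropagators, (3.39) p.397 + (3.8) p.392] -/
def dirRestr (ν : κ) : ((κ × S) × ι → ℝ) →ₗ[ℝ] (S × ι → ℝ) where
  toFun F := fun p => F ((ν, p.1), p.2)
  map_add' _ _ := rfl
  map_smul' _ _ := rfl

/-- Unfolding `dirRestr`. [cite: Balaban1985BackgroundPropagators, (3.39) p.397] -/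
@[simp] theorem dirRestr_apply (ν : κ) (F : (κ × S) × ι → ℝ) (p : S × ι) : dirRestr ν F p = F ((ν, p.1), p.2) := rfl

variable {g : B6.Geometry}

/-- A bond function supported in the block of `y′` (bond block map `q ↦ y(q.1.2)`, the block of the bond's base point) restricts, in every direction,
to a site function supported in the block of `y′` with the same bound. [cite: Balaban1984PropagatorsII, (2.51) p.232] -/
theorem blockSupp_dirRestr (blk : S → g.Site) {F : (κ × S) × ι → ℝ} {y' : g.Site} {B : ℝ}
    (hF : BlockSupp (fun q : (κ × S) × ι => blk q.1.2) F y' B) (ν : κ) :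
    BlockSupp (fun p : S × ι => blk p.1) (dirRestr ν F) y' B :=
  ⟨hF.nonneg, fun p hp => by simpa using hF.bound ((ν, p.1), p.2) hp, fun p hp => by simpa using hF.off ((ν, p.1), p.2) hp⟩

variable {E : Type*} [NormedAddCommGroup E] [NormedSpace ℝ E] [Fintype ι] (b : Module.Basis ι ℝ E)

/-- The `E`-valued direction-`ν` component of `coord⁻¹F` is `coord⁻¹` of the direction-`ν` restriction:
`(z ↦ (coord⁻¹F)(ν,z)) = coord⁻¹(dirRestr ν F)`. [folklore] [cite: Balaban1984PropagatorsII, (2.51) p.232] -/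
theorem coordEquiv_symm_dir (ν : κ) (F : (κ × S) × ι → ℝ) :
    (fun z => (coordEquiv (S := κ × S) b).symm F (ν, z)) = (coordEquiv b).symm (dirRestr ν F) := by
  funext z
  rw [coordEquiv_symm_apply, coordEquiv_symm_apply]
  rfl

end Restrict

/-! ## §2  Pointwise identities between the two typings of `D_U`, `D*_U` -/

section Pointwise

variable {𝔸 : Type*} [NormedRing 𝔸] [NormedAlgebra ℂ 𝔸] {ι : Type} [Fintype ι]
variable (b : Module.Basis ι ℝ 𝔸) {S : Type} {κ : Type}
variable (T : κ → Equiv.Perm S) (V : κ → S → 𝔸ˣ)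

/-- **`D` (sites → bonds) at the bond `(μ, x)` IS the directional letter `∇_{inl μ}` at `x`**: `(conjHom b (gradLin T c V) m)((μ,x),i) = (conj b (diffLetter
T V c (inl μ)) m)(x,i)` — (3.3): «(D^η_{U,μ}A)(x) = (D^η_UA)(x, x + ηe_μ)». [cite: Balaban1985BackgroundPropagators, (3.3) p.391] -/
theorem conjHom_gradLin_apply (c : ℂ) (m : S × ι → ℝ) (q : (κ × S) × ι) :
    conjHom b (gradLin T c V) m q = conj b (diffLetter T V c (Sum.inl q.1.1)) m (q.1.2, q.2) := by
  rw [conjHom_apply, gradLin_apply, conj_apply, diffLetter_inl, gradLetterF_apply]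

/-- The same after a site letter `P`: `(D ∘ P) m` at the bond `(μ,x)` = `(∇_{inl μ}·P) m` at `x`. [cite: Balaban1985BackgroundPropagators, (3.3) p.391 + (3.49) p.399] -/
theorem conjHom_gradLin_comp_apply (c : ℂ) (P : Module.End ℝ (S × ι → ℝ)) (m : S × ι → ℝ) (q : (κ × S) × ι) :
    (conjHom b (gradLin T c V) ∘ₗ P) m q = (conj b (diffLetter T V c (Sum.inl q.1.1)) * P) m (q.1.2, q.2) := by
  rw [LinearMap.comp_apply, Module.End.mul_apply, conjHom_gradLin_apply]

variable [Fintype κ]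

/-- **`D*` (bonds → sites) IS the sum of the directional letters `−∇_{inr ν}` applied to the components**: `conjHom b (divLin T c V) F =
−Σ_ν conj b (diffLetter T V c (inr ν)) (dirRestr ν F)` — (3.8): «(D\*A)(x) = Σ_{μ=1}^d (D\*_μA_μ)(x)», with `diffLetter (inr ν) = −c·D*_ν`.
[cite: Balaban1985BackgroundPropagators, (3.8) p.392 + (3.3) p.391] -/
theorem conjHom_divLin_eq_sum (c : ℂ) (F : (κ × S) × ι → ℝ) :
    conjHom b (divLin T c V) F = -∑ ν, conj b (diffLetter T V c (Sum.inr ν)) (dirRestr ν F) := by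
  funext p
  rw [conjHom_apply, divLin_apply, Pi.neg_apply, Finset.sum_apply, Finset.smul_sum, map_sum, Finsupp.coe_finsetSum,
    Finset.sum_apply, ← Finset.sum_neg_distrib]
  refine Finset.sum_congr rfl fun ν _ => ?_
  rw [conj_apply, diffLetter_inr, LinearMap.neg_apply, Pi.neg_apply, gradLetterB_apply, map_neg, Finsupp.coe_neg, Pi.neg_apply,
    neg_neg, ← coordEquiv_symm_dir b ν F]

/-- The same after a site letter `P` on the left: `(P ∘ D*) F = −Σ_ν (P·∇_{inr ν})(F_ν)`. [cite: Balaban1985BackgroundPropagators, (3.8) p.392 + (3.49) p.399] -/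
theorem comp_conjHom_divLin_apply (c : ℂ) (P : Module.End ℝ (S × ι → ℝ)) (F : (κ × S) × ι → ℝ) :
    (P ∘ₗ conjHom b (divLin T c V)) F = -∑ ν, (P * conj b (diffLetter T V c (Sum.inr ν))) (dirRestr ν F) := by
  rw [LinearMap.comp_apply, conjHom_divLin_eq_sum, map_neg, map_sum]
  rfl

/-- The two-sided dressing: `(D ∘ P ∘ D*) F` at the bond `(μ,x)` = `−Σ_ν (∇_{inl μ}·P·∇_{inr ν})(F_ν)` at `x`.
[cite: Balaban1985BackgroundPropagators, (3.3) p.391 + (3.8) p.392 + (3.49) p.399] -/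
theorem conjHom_gradLin_comp_comp_divLin_apply (c : ℂ) (P : Module.End ℝ (S × ι → ℝ)) (F : (κ × S) × ι → ℝ) (q : (κ × S) × ι) :
    (conjHom b (gradLin T c V) ∘ₗ P ∘ₗ conjHom b (divLin T c V)) F q
      = -∑ ν, (conj b (diffLetter T V c (Sum.inl q.1.1)) * P * conj b (diffLetter T V c (Sum.inr ν))) (dirRestr ν F) (q.1.2, q.2) := by
  rw [LinearMap.comp_apply, comp_conjHom_divLin_apply, map_neg, map_sum, Pi.neg_apply, Finset.sum_apply]
  rfl

end Pointwise

/-! ## §3  The dictionary for block majorants -/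

section Dictionary

variable {𝔸 : Type*} [NormedRing 𝔸] [NormedAlgebra ℂ 𝔸] {ι : Type} [Fintype ι]
variable (b : Module.Basis ι ℝ 𝔸) {S : Type} {κ : Type}
variable (T : κ → Equiv.Perm S) (V : κ → S → 𝔸ˣ)
variable {g : B9.Geometry} [Fintype g.Site] {R : ℝ} {H : Prop}

/-- **Sites → bonds**: if every directional dressing `∇_{inl μ}·P` (`μ ∈ κ`) of a site letter `P` has the block majorant `K`, then the typed composite
`D ∘ P : (S × ι → ℝ) → ((κ × S) × ι → ℝ)` has the two-space majorant `K` (bond block map = block of the base point) — the shape `hDP` of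
`B9Ineq377POneConcrete.thm34_G_entries13_concreteV₃P₁` from the shape `h342_2` of `B9Ineq368Vprime`.
[cite: Balaban1985BackgroundPropagators, (3.3) p.391 + (3.42) p.397 + (3.49) p.399 + (3.68) p.403; Balaban1984PropagatorsII, (2.51) p.232] -/
theorem hasMajorantHom_gradLin_comp (blk : S → g.Site) (c : ℂ) {P : Module.End ℝ (S × ι → ℝ)} {K : g.Site → g.Site → ℝ}
    (h : ∀ μ : κ, HasMajorant (g := toB6 g R H) (fun p : S × ι => blk p.1) (conj b (diffLetter T V c (Sum.inl μ)) * P) K) :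
    HasMajorantHom (g := toB6 g R H) (fun p : S × ι => blk p.1) (fun q : (κ × S) × ι => blk q.1.2)
      (conjHom b (gradLin T c V) ∘ₗ P) K := by
  intro y' m B hm q
  rw [conjHom_gradLin_comp_apply]
  exact h q.1.1 y' m B hm (q.1.2, q.2)

/-- The `P = 1` form: `(∀ μ, ∇_{inl μ}·G ≺ K) → D ∘ G ≺ K` for a site letter `G` written as the right factor (the shape `hDGp` of FILE 13).
[cite: Balaban1985BackgroundPropagators, (3.3) p.391 + (3.42) p.397; Balaban1984PropagatorsII, (2.51) p.232] -/
theorem hasMajorantHom_gradLin (blk : S → g.Site) (c : ℂ) {G : Module.End ℝ (S × ι → ℝ)} {K : g.Site → g.Site → ℝ}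
    (h : ∀ μ : κ, HasMajorant (g := toB6 g R H) (fun p : S × ι => blk p.1) (conj b (diffLetter T V c (Sum.inl μ)) * G) K) :
    HasMajorantHom (g := toB6 g R H) (fun p : S × ι => blk p.1) (fun q : (κ × S) × ι => blk q.1.2)
      (conjHom b (gradLin T c V) ∘ₗ G) K :=
  hasMajorantHom_gradLin_comp (R := R) (H := H) b T V blk c h

variable [Fintype κ]

omit [Fintype g.Site] in
/-- The sum over directions of one majorant bound per direction. [folklore] -/
private theorem abs_neg_sum_le {f : κ → ℝ} {C : ℝ} (h : ∀ ν, |f ν| ≤ C) : |-(∑ ν, f ν)| ≤ Fintype.card κ * C := by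
  rw [abs_neg]
  calc |∑ ν, f ν| ≤ ∑ ν, |f ν| := Finset.abs_sum_le_sum_abs _ _
    _ ≤ ∑ _ν : κ, C := Finset.sum_le_sum fun ν _ => h ν
    _ = Fintype.card κ * C := by rw [Finset.sum_const, Finset.card_univ, nsmul_eq_mul]

/-- **Bonds → sites**: if every directional dressing `P·∇_{inr ν}` (`ν ∈ κ`) of a site letter `P` has the block majorant `K`, then the typed composite
`P ∘ D* : ((κ × S) × ι → ℝ) → (S × ι → ℝ)` has the two-space majorant `card κ · K` (`D* = Σ_ν D*_ν`, (3.8)) — the shape `hPDs` of FILE 11/13 from the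
shape `h342_3`/`h342R` of `B9Ineq368Vprime`.
[cite: Balaban1985BackgroundPropagators, (3.8) p.392 + (3.42) p.397 + (3.49) p.399 + (3.68) p.403; Balaban1984PropagatorsII, (2.51) p.232] -/
theorem hasMajorantHom_comp_divLin (blk : S → g.Site) (c : ℂ) {P : Module.End ℝ (S × ι → ℝ)} {K : g.Site → g.Site → ℝ}
    (h : ∀ ν : κ, HasMajorant (g := toB6 g R H) (fun p : S × ι => blk p.1) (P * conj b (diffLetter T V c (Sum.inr ν))) K) :
    HasMajorantHom (g := toB6 g R H) (fun q : (κ × S) × ι => blk q.1.2) (fun p : S × ι => blk p.1)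
      (P ∘ₗ conjHom b (divLin T c V)) (fun a a' => Fintype.card κ * K a a') := by
  intro y' F B hF p
  rw [comp_conjHom_divLin_apply, Pi.neg_apply, Finset.sum_apply, mul_assoc]
  exact abs_neg_sum_le fun ν => h ν y' (dirRestr ν F) B (blockSupp_dirRestr (g := toB6 g R H) blk hF ν) p

/-- The `P = 1` form: `(∀ ν, G·∇_{inr ν} ≺ K) → G ∘ D* ≺ card κ · K` (the shape `hGpDs` of FILE 13).
[cite: Balaban1985BackgroundPropagators, (3.8) p.392 + (3.42) p.397; Balaban1984PropagatorsII, (2.51) p.232] -/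
theorem hasMajorantHom_divLin (blk : S → g.Site) (c : ℂ) {G : Module.End ℝ (S × ι → ℝ)} {K : g.Site → g.Site → ℝ}
    (h : ∀ ν : κ, HasMajorant (g := toB6 g R H) (fun p : S × ι => blk p.1) (G * conj b (diffLetter T V c (Sum.inr ν))) K) :
    HasMajorantHom (g := toB6 g R H) (fun q : (κ × S) × ι => blk q.1.2) (fun p : S × ι => blk p.1)
      (G ∘ₗ conjHom b (divLin T c V)) (fun a a' => Fintype.card κ * K a a') :=
  hasMajorantHom_comp_divLin (R := R) (H := H) b T V blk c h

/-- **Bonds → bonds, two-sided**: if every `∇_{inl μ}·P·∇_{inr ν}` has the block majorant `K`, then `D ∘ P ∘ D*` has the majorant `card κ · K` on the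
bond carrier — the shape `hDPpDs` of FILE 11/13 ((3.68)₄ `|(DP′(A)D*)_{μν}(x,x′)|`) from per-direction statements.
[cite: Balaban1985BackgroundPropagators, (3.3) p.391 + (3.8) p.392 + (3.68) p.403; Balaban1984PropagatorsII, (2.51) p.232] -/
theorem hasMajorant_gradLin_comp_comp_divLin (blk : S → g.Site) (c : ℂ) {P : Module.End ℝ (S × ι → ℝ)} {K : g.Site → g.Site → ℝ}
    (h : ∀ μ ν : κ, HasMajorant (g := toB6 g R H) (fun p : S × ι => blk p.1)
      (conj b (diffLetter T V c (Sum.inl μ)) * P * conj b (diffLetter T V c (Sum.inr ν))) K) :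
    HasMajorant (g := toB6 g R H) (fun q : (κ × S) × ι => blk q.1.2)
      (conjHom b (gradLin T c V) ∘ₗ P ∘ₗ conjHom b (divLin T c V)) (fun a a' => Fintype.card κ * K a a') := by
  intro y' F B hF q
  rw [conjHom_gradLin_comp_comp_divLin_apply, mul_assoc]
  exact abs_neg_sum_le fun ν => h q.1.1 ν y' (dirRestr ν F) B (blockSupp_dirRestr (g := toB6 g R H) blk hF ν) (q.1.2, q.2)

end Dictionary

end Literature.MathematicalPhysics.QuantumFieldTheory.Balaban1983to89.B9Eq376DerivDict

end
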